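import Literature.Barriers.QuantumAdvantage.FFKLWindow
import Literature.Barriers.QuantumAdvantage.FFKLSegments
import Literature.Barriers.QuantumAdvantage.FFKLTablePredicate
import Literature.Computability.Complexity.StandardAlgorithm
import Literature.Computability.Complexity.StackWords
import HarnessLib

/-!
# The certificate test of the Standard Algorithm for `AWPP^{B ⊕ ·}` descriptions (Fenner–Fortnow–Kurtz–Li, Lemma 6.17): the supplier of least good codes meets the specification

Support file for the named fact
`Literature.Barriers.QuantumAdvantage.fennerFortnowKurtzLi2003_thm618_awpp` (Fenner–Fortnow–
Kurtz–Li, *An oracle builder's toolkit*, Inform. and Comput. 182 (2003), Thm. 6.18 (2)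
rerelativized), continuing `FFKLWindow.lean` (the acceptance function `f = winFn` of an input,
its certificates, Thm. 6.13), `FFKLSegments.lean` (segment tables, the layered table `layerTBL`)
and `FFKLTablePredicate.lean` (the threshold test `accTable`), towards the Standard Algorithm
(`StandardAlgorithm.lean`: `StdAlg.PickSpec`, `StdAlg.decide_eq`).

**Lemma 6.17** (p. 33): "Fix a finite partial oracle `α` and `x` … Given any polynomial-size `β`
compatible with `α`, we decide whether or not it is a 1-certificate as follows: if `β` is not a
1-certificate, then there is an oracle extending `α ∪ β` that makes `M_j(x)` reject, hence there
is a polynomial-size 0-certificate `γ` compatible with `α ∪ β`; on the other hand, if `β` is a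
1-certificate, then there is no extension at all that makes `M_j(x)` reject. Thus, `β` is a
1-certificate iff, for all `γ` compatible with `α ∪ β` and with size at most `q(n)`,
`M^{α∪β∪γ}(x)` accepts, where all queries outside `dom(α ∪ β ∪ γ)` are answered negatively."

This file proves exactly this, in the tree's models, for a well-formed description `Δ`
categorical over `σ` (so that `f` has certificates of size `≤ 16·reach⁴`,
`exists_certificate_winFn`):

* `AWPPDescr.knowOf` — the partial assignment of the window read off a segment table (`InS`,
  `ValS`); `AWPPDescr.layerFill` — the total assignment "first `ρ`, then `β`, then `g`";
  `windowOf_tableLang` — the window of the oracle of a layered table code `⟨x, ⟨h, ⟨c, γ⟩⟩⟩` IS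
  `layerFill (knowOf h) (knowOf c) (valFn γ)`, whence `mem_accTable_iff_winFn`: the `PSPACE`
  test `accTable` of `FFKLTablePredicate.lean` computes `f` of that assignment ("`M^{α∪β∪γ}(x)`
  accepts");
* `AWPPDescr.GoodK ρ c` — "`c` passes the test of Lemma 6.17 over the knowledge `ρ`" (for all
  completions `γ` of the code length, `f = 1`); `AWPPDescr.IsLeastGood`; `AWPPDescr.pick` — the
  supplier returning the (effective part of the) least good code; `AWPPDescr.certCode` — the code
  of a partial assignment on a small set (the `β`, `γ` of the printed proof), with its table
  semantics `knowOf_certCode`;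
* PROVED: **`pickSpec`** — `pick` meets `StdAlg.PickSpec f`: a returned code is a relative
  1-certificate (else a failing input's 0-certificate, written as a completion `γ`, refutes the
  test) and `none` is returned only if no consistent input has value `1` (else such an input's
  certificate, written as a code, passes the test) — the two halves of Lemma 6.17 with the
  certificate bound of Thm. 6.13;
* the bookkeeping for the machine: `knowOf` of a concatenation of probe segments
  (`knowOf_flatten_probes`), of the empty table, and `winFn_fill_eq` (the verdict form).

## References

* [FennerFortnowKurtzLi2003IC] Lemma 6.17 (p. 33), Thm. 6.13 (pp. 31–32), Fig. 1 and Lemma 6.9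
  (p. 29), read via `lit read doi:10.1016/s0890-5401(03)00018-x --pages 25-34`.
* [BealsEtAl2001] Lemma 5.3 (the certificate-search algorithm behind Fig. 1).
-/

noncomputable section

namespace Literature.Barriers.QuantumAdvantage

open _root_.Computability Literature.Computability.Complexity Literature.Computability.Complexity.Classes
  Literature.Computability.Complexity.CohenCondition Literature.Computability.QuantumComplexity Finset
  CertificateAlgorithm FFKL

namespace AWPPDescr

/-! ### Definitions: knowledge read off tables, layered fill, codes, good codes, the supplier -/

open scoped Classical in
/-- **The partial assignment of the window read off a table** `s` (width `W`): the variable of a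
window string named by some segment of `s` gets the OR of the values of the segments naming it;
unnamed variables are unknown. [cite: FennerFortnowKurtzLi2003IC, Lemma 6.17 (p. 33, the finite partial oracles α, β, γ)] -/
def knowOf (Δ : AWPPDescr) (σ : CohenCondition) (n W : ℕ) (s : List Bool) : Fin (Δ.winCard σ n) → Option Bool := fun i =>
  if InS W s ((Δ.winEnum σ n i : Δ.window σ n) : List Bool) then
    some (if ValS W s ((Δ.winEnum σ n i : Δ.window σ n) : List Bool) then true else false)
  else none

open scoped Classical in
/-- The total assignment read off the last layer (value `1` iff some segment sets the string).
[cite: FennerFortnowKurtzLi2003IC, Lemma 6.17 (p. 33)] -/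
def valFn (Δ : AWPPDescr) (σ : CohenCondition) (n W : ℕ) (s : List Bool) : Fin (Δ.winCard σ n) → Bool := fun i =>
  if ValS W s ((Δ.winEnum σ n i : Δ.window σ n) : List Bool) then true else false

/-- **Layered fill**: the value of a variable is its value in `ρ` if known there, else in `β` if
known there, else `g` ("`M^{α∪β∪γ}`"). [cite: FennerFortnowKurtzLi2003IC, Lemma 6.17 (p. 33)] -/
def layerFill {N : ℕ} (ρ β : Fin N → Option Bool) (g : Fin N → Bool) : Fin N → Bool := fun i =>
  (ρ i).getD ((β i).getD (g i))

variable {Δ : AWPPDescr} {B : Language Bool} {σ : CohenCondition}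

/-! ### The knowledge read off a segment table -/

/-- Unknown in `knowOf` means unnamed. [folklore] -/
theorem knowOf_eq_none_iff {n W : ℕ} {s : List Bool} {i : Fin (Δ.winCard σ n)} :
    Δ.knowOf σ n W s i = none ↔ ¬ InS W s ((Δ.winEnum σ n i : Δ.window σ n) : List Bool) := by
  classical
  unfold knowOf
  split_ifs with h <;> simp [h]

/-- Known `b` in `knowOf` means named, with OR-value `b`. [folklore] -/
theorem knowOf_eq_some_iff {n W : ℕ} {s : List Bool} {i : Fin (Δ.winCard σ n)} {b : Bool} :
    Δ.knowOf σ n W s i = some b ↔ InS W s ((Δ.winEnum σ n i : Δ.window σ n) : List Bool) ∧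
      (ValS W s ((Δ.winEnum σ n i : Δ.window σ n) : List Bool) ↔ b = true) := by
  classical
  unfold knowOf
  cases b <;>
    by_cases h1 : InS W s ((Δ.winEnum σ n i : Δ.window σ n) : List Bool) <;>
      by_cases h2 : ValS W s ((Δ.winEnum σ n i : Δ.window σ n) : List Bool) <;> simp [h1, h2]

/-- `valFn` reads `ValS`. [folklore] -/
theorem valFn_eq_true_iff {n W : ℕ} {s : List Bool} {i : Fin (Δ.winCard σ n)} :
    Δ.valFn σ n W s i = true ↔ ValS W s ((Δ.winEnum σ n i : Δ.window σ n) : List Bool) := by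
  classical
  unfold valFn
  split_ifs with h <;> simp [h]

/-- The layered fill evaluates to `1` iff … (case analysis). [folklore] -/
theorem layerFill_eq_true_iff {N : ℕ} (ρ β : Fin N → Option Bool) (g : Fin N → Bool) (i : Fin N) :
    layerFill ρ β g i = true ↔
      ρ i = some true ∨ (ρ i = none ∧ (β i = some true ∨ (β i = none ∧ g i = true))) := by
  unfold layerFill
  cases ρ i with
  | some b => cases b <;> simp
  | none =>
    cases β i with
    | some b => cases b <;> simp
    | none => simp

/-- A variable known in `ρ` keeps its value. [folklore] -/
theorem layerFill_of_some {N : ℕ} {ρ : Fin N → Option Bool} (β : Fin N → Option Bool) (g : Fin N → Bool)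
    {i : Fin N} {b : Bool} (h : ρ i = some b) : layerFill ρ β g i = b := by
  simp [layerFill, h]

/-- A variable unknown in `ρ` but known in `β` takes its `β`-value. [folklore] -/
theorem layerFill_of_none_some {N : ℕ} {ρ β : Fin N → Option Bool} (g : Fin N → Bool) {i : Fin N} {b : Bool}
    (hρ : ρ i = none) (hβ : β i = some b) : layerFill ρ β g i = b := by
  simp [layerFill, hρ, hβ]

/-- A variable unknown in `ρ` and `β` takes its `g`-value. [folklore] -/
theorem layerFill_of_none_none {N : ℕ} {ρ β : Fin N → Option Bool} (g : Fin N → Bool) {i : Fin N}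
    (hρ : ρ i = none) (hβ : β i = none) : layerFill ρ β g i = g i := by
  simp [layerFill, hρ, hβ]

/-- The layered fill is consistent with its first layer. [folklore] -/
theorem consistent_layerFill {N : ℕ} (ρ β : Fin N → Option Bool) (g : Fin N → Bool) :
    Consistent (layerFill ρ β g) ρ := fun _ _ h => layerFill_of_some β g h

/-- With empty lower layers the layered fill is `fill`. [folklore] -/
theorem layerFill_none_false {N : ℕ} (ρ : Fin N → Option Bool) :
    layerFill ρ (fun _ => none) (fun _ => false) = fill ρ := by
  funext i
  simp [layerFill, fill]

/-! ### The window of a table oracle -/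

/-- The table code `⟨x, ⟨h, ⟨c, γ⟩⟩⟩` of knowledge `h`, candidate `c`, completion `γ`.
[cite: FennerFortnowKurtzLi2003IC, Lemma 6.17 (p. 33, α ∪ β ∪ γ)] -/
def tcode (x h c g : List Bool) : List Bool := boolPair x (boolPair h (boolPair c g))

/-- **The window of the oracle of a layered table is the layered fill of the knowledge read off
its three layers.** [cite: FennerFortnowKurtzLi2003IC, Lemma 6.17 (p. 33)] -/
theorem windowOf_tableLang (σ : CohenCondition) (Wp : Polynomial ℕ) (x h c g : List Bool) :
    Δ.windowOf σ x.length (tableLang (layerTBL σ Wp) (tcode x h c g)) =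
      layerFill (Δ.knowOf σ x.length (Wp.eval x.length) h) (Δ.knowOf σ x.length (Wp.eval x.length) c)
        (Δ.valFn σ x.length (Wp.eval x.length) g) := by
  funext i
  set w : List Bool := ((Δ.winEnum σ x.length i : Δ.window σ x.length) : List Bool) with hw
  have hval : σ.val w = none := Δ.val_winEnum σ x.length i
  have hdom : w ∉ σ.dom := by rw [mem_dom_iff, hval]; exact fun h => h rfl
  apply Bool.eq_iff_iff.2
  rw [layerFill_eq_true_iff]
  have hmem : Δ.windowOf σ x.length (tableLang (layerTBL σ Wp) (tcode x h c g)) i = true ↔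
      boolPair (tcode x h c g) w ∈ layerTBL σ Wp :=
    (Set.mem_iff_boolIndicator _ _).symm
  rw [hmem, tcode, mem_layerTBL_iff, hval]
  simp only [reduceCtorEq, false_or, hdom, not_false_eq_true, true_and]
  rw [knowOf_eq_some_iff, knowOf_eq_none_iff, knowOf_eq_some_iff, knowOf_eq_none_iff, valFn_eq_true_iff]
  simp only [iff_true]
  constructor
  · rintro (hv | ⟨hni, hv | ⟨hni', hv⟩⟩)
    · exact Or.inl ⟨hv.imp fun j hj => hj.1, hv⟩
    · exact Or.inr ⟨hni, Or.inl ⟨hv.imp fun j hj => hj.1, hv⟩⟩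
    · exact Or.inr ⟨hni, Or.inr ⟨hni', hv⟩⟩
  · rintro (⟨-, hv⟩ | ⟨hni, ⟨-, hv⟩ | ⟨hni', hv⟩⟩)
    · exact Or.inl hv
    · exact Or.inr ⟨hni, Or.inl hv⟩
    · exact Or.inr ⟨hni, Or.inr ⟨hni', hv⟩⟩

/-- The oracle of a layered table extends `σ`. [cite: FennerFortnowKurtzLi2003IC, §6.5 (p. 32)] -/
theorem extendedBy_tableLang_layerTBL (σ : CohenCondition) (Wp : Polynomial ℕ) (t : List Bool) :
    σ.ExtendedBy (tableLang (layerTBL σ Wp) t) :=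
  extendedBy_layerTBL σ Wp t

/-- **The `PSPACE` table test computes `f` of the layered fill**: for `Δ` well formed and
categorical over `σ`, `⟨x, ⟨x, ⟨h, ⟨c, γ⟩⟩⟩⟩ ∈ accTable` iff
`f(layerFill (knowOf h) (knowOf c) (valFn γ)) = 1` ("`M^{α∪β∪γ}(x)` accepts").
[cite: FennerFortnowKurtzLi2003IC, Lemma 6.17 (p. 33)] -/
theorem mem_accTable_iff_winFn (hwf : Δ.WellFormed) {B : Language Bool} {σ : CohenCondition}
    (hcat : Δ.Categorical B σ) (Wp : Polynomial ℕ) (x h c g : List Bool) :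
    boolPair x (tcode x h c g) ∈ accTable B (layerTBL σ Wp) Δ ↔
      Δ.winFn B σ x (layerFill (Δ.knowOf σ x.length (Wp.eval x.length) h)
        (Δ.knowOf σ x.length (Wp.eval x.length) c) (Δ.valFn σ x.length (Wp.eval x.length) g)) = true := by
  have hext := extendedBy_tableLang_layerTBL σ Wp (tcode x h c g)
  rw [boolPair_mem_accTable_iff_mem_lang (hcat _ hext x), Δ.mem_lang_iff_winFn hwf hext x,
    Δ.windowOf_tableLang σ Wp x h c g]

/-! ### Knowledge of concatenations of segments -/

/-- `InS` of a concatenation of width-`W` blocks, for a string no all-zero block names: some block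
names it. [folklore] -/
theorem InS_flatten_iff {W : ℕ} {bs : List (List Bool)} (hlen : ∀ b ∈ bs, b.length = W) {w : List Bool}
    (hw : w.length ≠ (W - 1) / 2) : InS W bs.flatten w ↔ ∃ b ∈ bs, segStr b = w := by
  constructor
  · rintro ⟨j, hj⟩
    by_cases hjl : j < bs.length
    · rw [segOf_flatten_of_lt hlen hjl] at hj
      exact ⟨bs[j], List.getElem_mem hjl, hj⟩
    · rw [segOf_flatten_of_le hlen (not_lt.1 hjl)] at hj
      have := congrArg List.length hj
      rw [length_segStr_replicate] at this
      exact absurd this.symm hw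
  · rintro ⟨b, hb, hbw⟩
    obtain ⟨j, hj, rfl⟩ := List.getElem_of_mem hb
    exact ⟨j, by rw [segOf_flatten_of_lt hlen hj]; exact hbw⟩

/-- `ValS` of a concatenation of width-`W` blocks: some block names the string with value `1`. [folklore] -/
theorem ValS_flatten_iff {W : ℕ} {bs : List (List Bool)} (hlen : ∀ b ∈ bs, b.length = W) (w : List Bool) :
    ValS W bs.flatten w ↔ ∃ b ∈ bs, segStr b = w ∧ segVal b := by
  constructor
  · rintro ⟨j, hj, hv⟩
    by_cases hjl : j < bs.length
    · rw [segOf_flatten_of_lt hlen hjl] at hj hv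
      exact ⟨bs[j], List.getElem_mem hjl, hj, hv⟩
    · rw [segOf_flatten_of_le hlen (not_lt.1 hjl)] at hv
      exact absurd hv (not_segVal_replicate W)
  · rintro ⟨b, hb, hbw, hv⟩
    obtain ⟨j, hj, rfl⟩ := List.getElem_of_mem hb
    exact ⟨j, by rw [segOf_flatten_of_lt hlen hj]; exact hbw, by rw [segOf_flatten_of_lt hlen hj]; exact hv⟩

/-- The enumeration of the window is injective on strings. [folklore] -/
theorem winEnum_val_injective (n : ℕ) {i i' : Fin (Δ.winCard σ n)}
    (h : ((Δ.winEnum σ n i : Δ.window σ n) : List Bool) = ((Δ.winEnum σ n i' : Δ.window σ n) : List Bool)) :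
    i = i' :=
  (Δ.winEnum σ n).injective (Subtype.ext h)

/-- Window strings are not named by all-zero segments of width `W ≥ 2·reach + 3`. [folklore] -/
theorem length_winEnum_ne {n W : ℕ} (hW : 2 * Δ.reach n + 2 ≤ W - 1) (i : Fin (Δ.winCard σ n)) :
    ((Δ.winEnum σ n i : Δ.window σ n) : List Bool).length ≠ (W - 1) / 2 := by
  have := Δ.length_winEnum_le σ n i
  omega

/-- **The knowledge read off a concatenation of probe segments** `code z · g(z)` (`z ∈ zs`): the
variable of a window string probed is known with value `g`, the others are unknown.
[cite: FennerFortnowKurtzLi2003IC, Fig. 1 (p. 29, "α := α ∪ (G restricted to …)")] -/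
theorem knowOf_flatten_probes {n W : ℕ} (hW : 2 * Δ.reach n + 2 ≤ W - 1) {zs : List (List Bool)}
    (hzs : ∀ z ∈ zs, 2 * z.length + 2 ≤ W - 1) (g : List Bool → Bool) (i : Fin (Δ.winCard σ n)) :
    Δ.knowOf σ n W ((zs.map fun z => mkCode (W - 1) z ++ [g z]).flatten) i =
      if ((Δ.winEnum σ n i : Δ.window σ n) : List Bool) ∈ zs then
        some (g ((Δ.winEnum σ n i : Δ.window σ n) : List Bool)) else none := by
  classical
  have hlen : ∀ b ∈ zs.map (fun z => mkCode (W - 1) z ++ [g z]), b.length = W := by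
    intro b hb
    obtain ⟨z, hz, rfl⟩ := List.mem_map.1 hb
    rw [length_mkCode_append (hzs z hz)]
    omega
  have hIn : InS W ((zs.map fun z => mkCode (W - 1) z ++ [g z]).flatten) ((Δ.winEnum σ n i : Δ.window σ n) : List Bool) ↔
      ((Δ.winEnum σ n i : Δ.window σ n) : List Bool) ∈ zs := by
    rw [InS_flatten_iff hlen (Δ.length_winEnum_ne hW i)]
    constructor
    · rintro ⟨b, hb, hbw⟩
      obtain ⟨z, hz, rfl⟩ := List.mem_map.1 hb
      rw [segStr_mkCode_append] at hbw
      subst hbw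
      exact hz
    · intro hz
      exact ⟨_, List.mem_map.2 ⟨_, hz, rfl⟩, segStr_mkCode_append _ _ _⟩
  have hVal : ValS W ((zs.map fun z => mkCode (W - 1) z ++ [g z]).flatten) ((Δ.winEnum σ n i : Δ.window σ n) : List Bool) ↔
      ((Δ.winEnum σ n i : Δ.window σ n) : List Bool) ∈ zs ∧ g ((Δ.winEnum σ n i : Δ.window σ n) : List Bool) = true := by
    rw [ValS_flatten_iff hlen]
    constructor
    · rintro ⟨b, hb, hbw, hv⟩
      obtain ⟨z, hz, rfl⟩ := List.mem_map.1 hb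
      rw [segStr_mkCode_append] at hbw
      rw [segVal_mkCode_append] at hv
      subst hbw
      exact ⟨hz, hv⟩
    · rintro ⟨hz, hg⟩
      exact ⟨_, List.mem_map.2 ⟨_, hz, rfl⟩, segStr_mkCode_append _ _ _, (segVal_mkCode_append _ _ _).2 hg⟩
  unfold knowOf
  by_cases hz : ((Δ.winEnum σ n i : Δ.window σ n) : List Bool) ∈ zs
  · rw [if_pos (hIn.2 hz), if_pos hz]
    cases hg : g ((Δ.winEnum σ n i : Δ.window σ n) : List Bool)
    · rw [if_neg (fun h => by simpa [hg] using (hVal.1 h).2)]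
    · rw [if_pos (hVal.2 ⟨hz, hg⟩)]
  · rw [if_neg (fun h => hz (hIn.1 h)), if_neg hz]

/-- The empty table knows nothing. [folklore] -/
theorem knowOf_nil {n W : ℕ} (hW : 2 * Δ.reach n + 2 ≤ W - 1) (i : Fin (Δ.winCard σ n)) :
    Δ.knowOf σ n W [] i = none := by
  have h := Δ.knowOf_flatten_probes (σ := σ) hW (zs := []) (fun z hz => by simp at hz) (fun _ => false) i
  simpa using h

/-- The empty table sets nothing. [folklore] -/
theorem valFn_nil {n W : ℕ} (i : Fin (Δ.winCard σ n)) : Δ.valFn σ n W [] i = false := by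
  classical
  unfold valFn
  rw [if_neg]
  rintro ⟨j, -, hv⟩
  have : segOf W [] j = List.replicate W false := segOf_eq_replicate_of_le (by simp)
  rw [this] at hv
  exact not_segVal_replicate W hv

/-- **The verdict form**: with empty candidate and completion the layered fill is `fill`, so the
table test of `⟨x, ⟨h, ⟨ε, ε⟩⟩⟩` computes `f(fill(knowledge of h))` — the verdict of the Standard
Algorithm (`StdAlg.decide`). [cite: FennerFortnowKurtzLi2003IC, Fig. 1 (p. 29)] [cite: BealsEtAl2001, Lemma 5.3 (proof, "Pick a consistent Y and return f(Y)")] -/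
theorem layerFill_knowOf_nil {n W : ℕ} (hW : 2 * Δ.reach n + 2 ≤ W - 1) (ρ : Fin (Δ.winCard σ n) → Option Bool) :
    layerFill ρ (Δ.knowOf σ n W []) (Δ.valFn σ n W []) = fill ρ := by
  have h1 : Δ.knowOf σ n W [] = fun _ => none := funext fun i => Δ.knowOf_nil hW i
  have h2 : Δ.valFn σ n W [] = fun _ => false := funext fun i => Δ.valFn_nil i
  rw [h1, h2, layerFill_none_false]

/-! ### Codes of partial assignments on small sets -/


/-- The probe segments `code(w_i) · y(i)`, `i ∈ S`. [cite: FennerFortnowKurtzLi2003IC, Lemma 6.17 (p. 33, "polynomial-size partial oracle β")] -/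
def certBlocks (Δ : AWPPDescr) (σ : CohenCondition) (n W : ℕ) (S : Finset (Fin (Δ.winCard σ n))) (y : Fin (Δ.winCard σ n) → Bool) : List (List Bool) :=
  S.toList.map fun i => mkCode (W - 1) ((Δ.winEnum σ n i : Δ.window σ n) : List Bool) ++ [y i]

/-- **The code of the partial assignment `y ↾ S`**: its probe segments, padded with all-zero
segments to `Cs` segments. [cite: FennerFortnowKurtzLi2003IC, Lemma 6.17 (p. 33, β and γ of size ≤ q(n))] -/
def certCode (Δ : AWPPDescr) (σ : CohenCondition) (n W Cs : ℕ) (S : Finset (Fin (Δ.winCard σ n))) (y : Fin (Δ.winCard σ n) → Bool) : List Bool :=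
  (Δ.certBlocks σ n W S y ++ List.replicate (Cs - S.card) (List.replicate W false)).flatten

/-- All blocks of a certificate code have width `W`. [folklore] -/
theorem length_of_mem_certBlocks_append {n W Cs : ℕ} (hW : 2 * Δ.reach n + 2 ≤ W - 1)
    (S : Finset (Fin (Δ.winCard σ n))) (y : Fin (Δ.winCard σ n) → Bool) :
    ∀ b ∈ Δ.certBlocks σ n W S y ++ List.replicate (Cs - S.card) (List.replicate W false), b.length = W := by
  intro b hb
  rcases List.mem_append.1 hb with hb | hb
  · obtain ⟨i, -, rfl⟩ := List.mem_map.1 hb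
    have := Δ.length_winEnum_le σ n i
    rw [length_mkCode_append (by omega)]
    omega
  · rw [(List.mem_replicate.1 hb).2, List.length_replicate]

/-- **The code has length `Cs·W`** when `|S| ≤ Cs`. [cite: FennerFortnowKurtzLi2003IC, Lemma 6.17 (p. 33)] -/
theorem length_certCode {n W Cs : ℕ} (hW : 2 * Δ.reach n + 2 ≤ W - 1) {S : Finset (Fin (Δ.winCard σ n))}
    (hS : S.card ≤ Cs) (y : Fin (Δ.winCard σ n) → Bool) : (Δ.certCode σ n W Cs S y).length = Cs * W := by
  unfold certCode
  rw [length_flatten_of_blocks (Δ.length_of_mem_certBlocks_append hW S y), List.length_append, certBlocks,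
    List.length_map, Finset.length_toList, List.length_replicate]
  congr 1
  omega

/-- **The table semantics of a certificate code**: it names exactly the strings of `S`, with the
values of `y`. [cite: FennerFortnowKurtzLi2003IC, Lemma 6.17 (p. 33)] -/
theorem InS_certCode_iff {n W Cs : ℕ} (hW : 2 * Δ.reach n + 2 ≤ W - 1) (S : Finset (Fin (Δ.winCard σ n)))
    (y : Fin (Δ.winCard σ n) → Bool) (i : Fin (Δ.winCard σ n)) :
    InS W (Δ.certCode σ n W Cs S y) ((Δ.winEnum σ n i : Δ.window σ n) : List Bool) ↔ i ∈ S := by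
  unfold certCode
  rw [InS_flatten_iff (Δ.length_of_mem_certBlocks_append hW S y) (Δ.length_winEnum_ne hW i)]
  constructor
  · rintro ⟨b, hb, hbw⟩
    rcases List.mem_append.1 hb with hb | hb
    · obtain ⟨i', hi', rfl⟩ := List.mem_map.1 hb
      rw [segStr_mkCode_append] at hbw
      rw [← Δ.winEnum_val_injective n hbw]
      exact Finset.mem_toList.1 hi'
    · rw [(List.mem_replicate.1 hb).2] at hbw
      have := congrArg List.length hbw
      rw [length_segStr_replicate] at this
      exact absurd this.symm (Δ.length_winEnum_ne hW i)
  · intro hi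
    exact ⟨_, List.mem_append_left _ (List.mem_map.2 ⟨i, Finset.mem_toList.2 hi, rfl⟩), segStr_mkCode_append _ _ _⟩

/-- The values named by a certificate code. [cite: FennerFortnowKurtzLi2003IC, Lemma 6.17 (p. 33)] -/
theorem ValS_certCode_iff {n W Cs : ℕ} (hW : 2 * Δ.reach n + 2 ≤ W - 1) (S : Finset (Fin (Δ.winCard σ n)))
    (y : Fin (Δ.winCard σ n) → Bool) (i : Fin (Δ.winCard σ n)) :
    ValS W (Δ.certCode σ n W Cs S y) ((Δ.winEnum σ n i : Δ.window σ n) : List Bool) ↔ i ∈ S ∧ y i = true := by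
  unfold certCode
  rw [ValS_flatten_iff (Δ.length_of_mem_certBlocks_append hW S y)]
  constructor
  · rintro ⟨b, hb, hbw, hv⟩
    rcases List.mem_append.1 hb with hb | hb
    · obtain ⟨i', hi', rfl⟩ := List.mem_map.1 hb
      rw [segStr_mkCode_append] at hbw
      rw [segVal_mkCode_append] at hv
      obtain rfl := Δ.winEnum_val_injective n hbw
      exact ⟨Finset.mem_toList.1 hi', hv⟩
    · rw [(List.mem_replicate.1 hb).2] at hv
      exact absurd hv (not_segVal_replicate W)
  · rintro ⟨hi, hy⟩
    exact ⟨_, List.mem_append_left _ (List.mem_map.2 ⟨i, Finset.mem_toList.2 hi, rfl⟩), segStr_mkCode_append _ _ _,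
      (segVal_mkCode_append _ _ _).2 hy⟩

/-- **The knowledge read off a certificate code is `y ↾ S`.** [cite: FennerFortnowKurtzLi2003IC, Lemma 6.17 (p. 33)] -/
theorem knowOf_certCode {n W Cs : ℕ} (hW : 2 * Δ.reach n + 2 ≤ W - 1) (S : Finset (Fin (Δ.winCard σ n)))
    (y : Fin (Δ.winCard σ n) → Bool) (i : Fin (Δ.winCard σ n)) :
    Δ.knowOf σ n W (Δ.certCode σ n W Cs S y) i = if i ∈ S then some (y i) else none := by
  classical
  unfold knowOf
  by_cases hi : i ∈ S
  · rw [if_pos ((Δ.InS_certCode_iff hW S y i).2 hi), if_pos hi]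
    cases hy : y i
    · rw [if_neg (fun h => by simpa [hy] using ((Δ.ValS_certCode_iff hW S y i).1 h).2)]
    · rw [if_pos ((Δ.ValS_certCode_iff hW S y i).2 ⟨hi, hy⟩)]
  · rw [if_neg (fun h => hi ((Δ.InS_certCode_iff hW S y i).1 h)), if_neg hi]

/-- The last-layer values of a certificate code are `y` on `S`, `0` elsewhere. [cite: FennerFortnowKurtzLi2003IC, Lemma 6.17 (p. 33)] -/
theorem valFn_certCode {n W Cs : ℕ} (hW : 2 * Δ.reach n + 2 ≤ W - 1) (S : Finset (Fin (Δ.winCard σ n)))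
    (y : Fin (Δ.winCard σ n) → Bool) (i : Fin (Δ.winCard σ n)) (hi : i ∈ S) :
    Δ.valFn σ n W (Δ.certCode σ n W Cs S y) i = y i := by
  apply Bool.eq_iff_iff.2
  rw [Δ.valFn_eq_true_iff, Δ.ValS_certCode_iff hW S y i]
  exact ⟨fun h => h.2, fun h => ⟨hi, h⟩⟩

/-! ### Good codes, the least good code, and the supplier -/


/-- **`c` passes the certificate test over the knowledge `ρ`** ("for all `γ` … `M^{α∪β∪γ}(x)`
accepts"): for every completion `g` of the code length `Lc`, `f` of the layered fill is `1`.
[cite: FennerFortnowKurtzLi2003IC, Lemma 6.17 (p. 33)] -/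
def GoodK (Δ : AWPPDescr) (B : Language Bool) (σ : CohenCondition) (x : List Bool) (W Lc : ℕ) (ρ : Fin (Δ.winCard σ x.length) → Option Bool) (c : List Bool) : Prop :=
  ∀ g : List Bool, g.length = Lc →
    Δ.winFn B σ x (layerFill ρ (Δ.knowOf σ x.length W c) (Δ.valFn σ x.length W g)) = true

/-- **The least good code** of length `Lc` (least binary value; the canonical choice the `PSPACE`
side spells out, cf. the "standard prefix search" of Lemma 6.17). [cite: FennerFortnowKurtzLi2003IC, Lemma 6.17 (p. 33, "find either kind of certificate using a standard prefix search")] -/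
def IsLeastGood (Δ : AWPPDescr) (B : Language Bool) (σ : CohenCondition) (x : List Bool) (W Lc : ℕ) (ρ : Fin (Δ.winCard σ x.length) → Option Bool) (c : List Bool) : Prop :=
  c.length = Lc ∧ Δ.GoodK B σ x W Lc ρ c ∧
    ∀ c' : List Bool, c'.length = Lc → bitsToNat c' < bitsToNat c → ¬ Δ.GoodK B σ x W Lc ρ c'

/-- **The effective certificate of a code**: its knowledge off the domain of `ρ` (what the round
learns; compatible with `ρ` by construction). [cite: FennerFortnowKurtzLi2003IC, Lemma 6.17 (p. 33, "β compatible with α")] -/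
def effCert (Δ : AWPPDescr) (σ : CohenCondition) (n W : ℕ) (ρ : Fin (Δ.winCard σ n) → Option Bool) (c : List Bool) : Fin (Δ.winCard σ n) → Option Bool :=
  fun i => if ρ i = none then Δ.knowOf σ n W c i else none

open scoped Classical in
/-- **The certificate supplier of the Standard Algorithm**: the effective certificate of the least
good code, if some code is good. [cite: FennerFortnowKurtzLi2003IC, §6.3 eq. (6) (p. 29, f^σ(x, α)) and Lemma 6.17 (p. 33)] -/
def pick (Δ : AWPPDescr) (B : Language Bool) (σ : CohenCondition) (x : List Bool) (W Lc : ℕ) (ρ : Fin (Δ.winCard σ x.length) → Option Bool) :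
    Option (Fin (Δ.winCard σ x.length) → Option Bool) :=
  if h : ∃ c, Δ.IsLeastGood B σ x W Lc ρ c then some (Δ.effCert σ x.length W ρ (Classical.choose h)) else none

/-! ### Least good codes -/

/-- Least good codes are unique. [folklore] -/
theorem IsLeastGood.unique {x : List Bool} {W Lc : ℕ} {ρ : Fin (Δ.winCard σ x.length) → Option Bool} {c c' : List Bool}
    (hc : Δ.IsLeastGood B σ x W Lc ρ c) (hc' : Δ.IsLeastGood B σ x W Lc ρ c') : c = c' := by
  rcases lt_trichotomy (bitsToNat c) (bitsToNat c') with h | h | h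
  · exact absurd hc.2.1 (hc'.2.2 c hc.1 h)
  · exact bitsToNat_injOn_length Lc hc.1 hc'.1 h
  · exact absurd hc'.2.1 (hc.2.2 c' hc'.1 h)

/-- A good code of the right length yields a least good code. [folklore] -/
theorem exists_isLeastGood_of_goodK {x : List Bool} {W Lc : ℕ} {ρ : Fin (Δ.winCard σ x.length) → Option Bool}
    {c : List Bool} (hlen : c.length = Lc) (hc : Δ.GoodK B σ x W Lc ρ c) : ∃ c', Δ.IsLeastGood B σ x W Lc ρ c' := by
  classical
  let good : Finset (List.Vector Bool Lc) := Finset.univ.filter fun v => Δ.GoodK B σ x W Lc ρ v.toList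
  have hne : good.Nonempty := ⟨⟨c, hlen⟩, Finset.mem_filter.2 ⟨Finset.mem_univ _, hc⟩⟩
  obtain ⟨v, hv, hmin⟩ := good.exists_min_image (fun v => bitsToNat v.toList) hne
  refine ⟨v.toList, v.toList_length, (Finset.mem_filter.1 hv).2, fun c' hc' hlt hgood => ?_⟩
  have := hmin ⟨c', hc'⟩ (Finset.mem_filter.2 ⟨Finset.mem_univ _, hgood⟩)
  exact absurd hlt (not_lt.2 this)

/-- `pick` returns `none` iff no code is good. [folklore] -/
theorem pick_eq_none_iff {x : List Bool} {W Lc : ℕ} {ρ : Fin (Δ.winCard σ x.length) → Option Bool} :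
    Δ.pick B σ x W Lc ρ = none ↔ ¬ ∃ c, Δ.IsLeastGood B σ x W Lc ρ c := by
  classical
  unfold pick
  split_ifs with h <;> simp [h]

/-- `pick` returns the effective certificate of THE least good code. [folklore] -/
theorem pick_eq_some_of_isLeastGood {x : List Bool} {W Lc : ℕ} {ρ : Fin (Δ.winCard σ x.length) → Option Bool}
    {c : List Bool} (hc : Δ.IsLeastGood B σ x W Lc ρ c) :
    Δ.pick B σ x W Lc ρ = some (Δ.effCert σ x.length W ρ c) := by
  classical
  unfold pick
  have h : ∃ c, Δ.IsLeastGood B σ x W Lc ρ c := ⟨c, hc⟩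
  rw [dif_pos h, (Classical.choose_spec h).unique hc]

/-- What `pick` returns. [folklore] -/
theorem exists_of_pick_eq_some {x : List Bool} {W Lc : ℕ} {ρ : Fin (Δ.winCard σ x.length) → Option Bool}
    {β : Fin (Δ.winCard σ x.length) → Option Bool} (h : Δ.pick B σ x W Lc ρ = some β) :
    ∃ c, Δ.IsLeastGood B σ x W Lc ρ c ∧ β = Δ.effCert σ x.length W ρ c := by
  classical
  unfold pick at h
  split_ifs at h with hex
  · exact ⟨_, Classical.choose_spec hex, (Option.some.inj h).symm⟩

/-- The effective certificate is compatible with `ρ`. [cite: FennerFortnowKurtzLi2003IC, Lemma 6.17 (p. 33, "β compatible with α")] -/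
theorem compatible_effCert {n W : ℕ} (ρ : Fin (Δ.winCard σ n) → Option Bool) (c : List Bool) :
    StdAlg.Compatible ρ (Δ.effCert σ n W ρ c) := by
  intro i b b' hρ hβ
  unfold effCert at hβ
  rw [if_neg (by rw [hρ]; exact Option.some_ne_none b)] at hβ
  cases hβ

/-- Off the domain of `ρ`, the effective certificate is the knowledge of the code. [folklore] -/
theorem effCert_of_none {n W : ℕ} {ρ : Fin (Δ.winCard σ n) → Option Bool} (c : List Bool) {i : Fin (Δ.winCard σ n)}
    (h : ρ i = none) : Δ.effCert σ n W ρ c i = Δ.knowOf σ n W c i := by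
  unfold effCert
  rw [if_pos h]

/-! ### The supplier meets the specification (Lemma 6.17) -/

/-- **A good code is a relative 1-certificate** (first half of Lemma 6.17: "if `β` is not a
1-certificate, then there is an oracle extending `α ∪ β` that makes `M_j(x)` reject, hence there
is a polynomial-size 0-certificate `γ` compatible with `α ∪ β`" — here: the failing input's
certificate of Thm. 6.13, written as a completion code, refutes the test).
[cite: FennerFortnowKurtzLi2003IC, Lemma 6.17 (p. 33) with Thm. 6.13] -/
theorem relCert_of_goodK (hcat : Δ.Categorical B σ) (x : List Bool) {W Cs : ℕ}
    (hW : 2 * Δ.reach x.length + 2 ≤ W - 1) (hCs : 16 * Δ.reach x.length ^ 4 ≤ Cs)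
    {ρ : Fin (Δ.winCard σ x.length) → Option Bool} {c : List Bool} (hc : Δ.GoodK B σ x W (Cs * W) ρ c) :
    StdAlg.RelCert (Δ.winFn B σ x) ρ (Δ.effCert σ x.length W ρ c) := by
  intro y hyρ hyβ
  by_contra hfy
  rw [Bool.not_eq_true] at hfy
  obtain ⟨S, hS, hcard⟩ := Δ.exists_certificate_winFn hcat x y
  have hγ := hc (Δ.certCode σ x.length W Cs S y) (Δ.length_certCode hW (hcard.trans hCs) y)
  have hagree : ∀ i ∈ S, layerFill ρ (Δ.knowOf σ x.length W c) (Δ.valFn σ x.length W (Δ.certCode σ x.length W Cs S y)) i = y i := by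
    intro i hi
    cases hρ : ρ i with
    | some b => rw [layerFill_of_some _ _ hρ, hyρ i b hρ]
    | none =>
      cases hβ : Δ.knowOf σ x.length W c i with
      | some b =>
        rw [layerFill_of_none_some _ hρ hβ]
        exact (hyβ i b (by rw [Δ.effCert_of_none c hρ, hβ])).symm
      | none => rw [layerFill_of_none_none _ hρ hβ, Δ.valFn_certCode hW S y i hi]
  rw [hS _ hagree, hfy] at hγ
  exact Bool.false_ne_true hγ

/-- **If a consistent input has value `1`, some code is good** (second half of Lemma 6.17: "if
`β` is a 1-certificate, then there is no extension at all that makes `M_j(x)` reject" — here: the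
input's certificate of Thm. 6.13, written as a code, passes the test).
[cite: FennerFortnowKurtzLi2003IC, Lemma 6.17 (p. 33) with Thm. 6.13] -/
theorem goodK_certCode (B : Language Bool) (x : List Bool) {W Cs : ℕ}
    (hW : 2 * Δ.reach x.length + 2 ≤ W - 1) {ρ : Fin (Δ.winCard σ x.length) → Option Bool}
    {y : Fin (Δ.winCard σ x.length) → Bool} (hyρ : Consistent y ρ) (hfy : Δ.winFn B σ x y = true)
    {S : Finset (Fin (Δ.winCard σ x.length))} (hS : IsCertificate (Δ.winFn B σ x) y S) :
    Δ.GoodK B σ x W (Cs * W) ρ (Δ.certCode σ x.length W Cs S y) := by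
  intro g _
  have hagree : ∀ i ∈ S, layerFill ρ (Δ.knowOf σ x.length W (Δ.certCode σ x.length W Cs S y)) (Δ.valFn σ x.length W g) i = y i := by
    intro i hi
    cases hρ : ρ i with
    | some b => rw [layerFill_of_some _ _ hρ, hyρ i b hρ]
    | none =>
      rw [layerFill_of_none_some _ hρ (by rw [Δ.knowOf_certCode hW S y i, if_pos hi])]
  rw [hS _ hagree, hfy]

/-- **The supplier meets the specification of the Standard Algorithm** (`StdAlg.PickSpec`): for
`Δ` categorical over `σ`, segment width `W ≥ 2·reach + 3` and `Cs ≥ 16·reach⁴` segments, a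
returned certificate is compatible and a relative 1-certificate, and `none` means no consistent
input has value `1`. [cite: FennerFortnowKurtzLi2003IC, Lemma 6.17 (p. 33), §6.3 eq. (6) and Lemma 6.9 (p. 29)] -/
theorem pickSpec (hcat : Δ.Categorical B σ) (x : List Bool) {W Cs : ℕ}
    (hW : 2 * Δ.reach x.length + 2 ≤ W - 1) (hCs : 16 * Δ.reach x.length ^ 4 ≤ Cs) :
    StdAlg.PickSpec (Δ.winFn B σ x) (Δ.pick B σ x W (Cs * W)) := by
  intro ρ
  constructor
  · intro β hβ
    obtain ⟨c, hc, rfl⟩ := Δ.exists_of_pick_eq_some hβ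
    exact ⟨Δ.compatible_effCert ρ c, Δ.relCert_of_goodK hcat x hW hCs hc.2.1⟩
  · intro hnone y hyρ
    by_contra hfy
    rw [Bool.not_eq_false] at hfy
    obtain ⟨S, hS, hcard⟩ := Δ.exists_certificate_winFn hcat x y
    have hgood := Δ.goodK_certCode B x hW (Cs := Cs) hyρ hfy hS
    obtain ⟨c', hc'⟩ := Δ.exists_isLeastGood_of_goodK (Δ.length_certCode hW (hcard.trans hCs) y) hgood
    exact Δ.pick_eq_none_iff.1 hnone ⟨c', hc'⟩

end AWPPDescr

end Literature.Barriers.QuantumAdvantage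

end
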